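import Literature.AnabelianGeometry.SemiGraphs.CoveringGraphChartGroup
import Literature.AnabelianGeometry.SemiGraphs.CoveringGraphVerticialDictionary
import Literature.AnabelianGeometry.SemiGraphs.CoveringGraphEdgeDictionary
import Literature.AnabelianGeometry.SemiGraphs.TemperedCompactInVerticialAt
import Literature.AnabelianGeometry.SemiGraphs.TemperedMaximalCompact
import Literature.AnabelianGeometry.SemiGraphs.TemperedPiChartExists
import Literature.AnabelianGeometry.SemiGraphs.TreeFixedPairProofs
import HarnessLib

/-!
# [SemiAnbd] Thm 3.7 (iii) AT a covering semi-graph of anabelioids (transfer along tempered coverings)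

Mochizuki, *Semi-graphs of anabelioids*, Publ. RIMS **42** (2006), §3, Theorem 3.7 (iii) pp. 40–41
[cite: MochizukiSemiAnbd2006, Thm 3.7(iii) pp.40-41] with Proposition 3.6 (v) p. 39.  Print proves
Thm. 3.7 (iii) for FINITE `G` ("Since the semi-graphs `𝔾_j` are all finite …", p. 41); the covering
semi-graphs of anabelioids `G_S → G` of its infinite tempered coverings `S` (universal graph-coverings,
the [EtTh] §1 infinite cyclic coverings) are infinite.  This file TRANSFERS the per-graph statement
`CompactInVerticialAt` (TemperedCompactInVerticialAt.lean) from `G` to `G_S` for every connected tempered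
`S`, for `G` as in Theorem 3.7 and coherent:

* a compact `C ≤ π₁^temp(G_S) ≅ Stab_Π(x₀)` (route-T brick T1, `CovObj.exists_chartGroup_compatIso`) is a
  compact subgroup of `Π = π₁^temp(G)`, hence lies in a verticial subgroup `H` of `G` at some `v`
  (hypothesis `CompactInVerticialAt G`), hence in the trace `H ∩ Stab_Π(x₀)`, which is a verticial
  subgroup of `G_S` at a vertex over `v` (brick T2, `CovObj.exists_isVerticialHom_coveringGraph`);
* conversely every verticial subgroup of `G_S` is such a trace (`exists_trace_of_mem_verticialSubgroups`,
  via Prop. 3.2's conjugacy `exists_conj_of_mem_verticialSubgroups`), and traces of distinct verticial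
  subgroups containing `C` come from distinct verticial subgroups — so "at most two" and "then inside an
  edge-like subgroup of a closed edge" transfer as well (edges: `CovObj.exists_isEdgeHom_coveringGraph`,
  closed edges lift: `isClosedEdge_coveringSemiGraph`).

Main theorem `compactInVerticialAt_coveringGraph`.  Proof-only (abc-iut cell, L3 route T, brick T3;
L3-lead ruling α42 (3)).  Nothing here asserts Thm 3.7 (iii) for an arbitrary infinite `G`, and
nothing here bears on [IUTchIII] Cor. 3.12.
-/

noncomputable section

open CategoryTheory CategoryTheory.Limits Topology

namespace Literature.AnabelianGeometry.SemiGraphs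

open Literature.AlgebraicGeometry.Frobenioids (IsConnectedObj)
open Literature.AlgebraicGeometry.Frobenioids.QuasiTemperoid.BTempConnected (hom_ρ hom_ext_apply
  ρ_one_apply ρ_mul_apply ρ_inv_apply nonempty_of_isConnectedObj)
open GaloisObjects (iso_inv_hom_apply iso_hom_inv_apply)

universe u

/-! ### Closed edges lift to the covering semi-graph -/

namespace SemiGraph

/-- Every branch of a closed edge abuts to a vertex (an edge has exactly two branches, and a closed
edge has two abutting ones). [cite: MochizukiSemiAnbd2006, §1 p.12] -/
theorem abuts_isSome_of_isClosedEdge {G : SemiGraph.{u}} {e : G.Edge} (he : G.IsClosedEdge e)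
    (b : G.Branch) (hb : G.edgeOf b = e) : (G.abuts b).isSome := by
  unfold SemiGraph.IsClosedEdge SemiGraph.vertCard at he
  obtain ⟨x, y, hxy, -⟩ := Nat.card_eq_two_iff.mp he
  obtain ⟨b₁, b₂, -, -, -, hall⟩ := G.two_branches e
  rcases hall b hb with rfl | rfl
  · rcases hall x.1 x.2.1 with hx | hx
    · exact hx ▸ x.2.2
    · rcases hall y.1 y.2.1 with hy | hy
      · exact hy ▸ y.2.2
      · exact absurd (Subtype.ext (hx.trans hy.symm)) hxy
  · rcases hall x.1 x.2.1 with hx | hx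
    · rcases hall y.1 y.2.1 with hy | hy
      · exact absurd (Subtype.ext (hx.trans hy.symm)) hxy
      · exact hy ▸ y.2.2
    · exact hx ▸ x.2.2

end SemiGraph

namespace ProfiniteSemiGraph

namespace CovObj

variable {𝒢 : ProfiniteSemiGraph.{u}} (S : CovObj 𝒢)

/-- **Closed edges of `G` lift to closed edges of `G_S`**: the edge `(e, ω)` of the covering semi-graph
over a closed edge `e` is closed. [cite: MochizukiSemiAnbd2006, Def 3.5(i) p.37] -/
theorem isClosedEdge_coveringSemiGraph {e : 𝒢.graph.Edge} (he : 𝒢.graph.IsClosedEdge e)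
    (ω : BTemp.Orbits (S.SE e)) : S.coveringSemiGraph.IsClosedEdge ⟨e, ω⟩ := by
  obtain ⟨⟨b₁, ω₁⟩, ⟨b₂, ω₂⟩, hne, h₁, h₂, -⟩ := S.coveringSemiGraph.two_branches ⟨e, ω⟩
  have hb₁ : 𝒢.graph.edgeOf b₁ = e := congrArg Sigma.fst h₁
  have hb₂ : 𝒢.graph.edgeOf b₂ = e := congrArg Sigma.fst h₂
  obtain ⟨w₁, hw₁⟩ := Option.isSome_iff_exists.mp (SemiGraph.abuts_isSome_of_isClosedEdge he b₁ hb₁)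
  obtain ⟨w₂, hw₂⟩ := Option.isSome_iff_exists.mp (SemiGraph.abuts_isSome_of_isClosedEdge he b₂ hb₂)
  exact SemiGraph.isClosedEdge_of_abuts hne h₁ h₂ (S.coveringAbuts_eq hw₁ ω₁) (S.coveringAbuts_eq hw₂ ω₂)

/-! ### Verticial homomorphisms of `G_S` at a PRESCRIBED vertex over `v` -/

/-- **Normalisation at a prescribed orbit**: for the chart image `X_S` of a CONNECTED `S` (a transitive
`Π`-set), a verticial `χ₀` at `v` and any orbit `ω` of `S_v`, some `Π`-conjugate `χ` of `χ₀` admits a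
comparison isomorphism sending `s_ω = Quot.out ω` to the base point `x₀`.
[cite: MochizukiSemiAnbd2006, Thm 3.7(i) p.40] -/
theorem exists_isVerticialHom_normalised_at (c : TemperedPiChart 𝒢) (hS : S.IsTempered)
    (hSc : IsConnectedObj (⟨S, hS⟩ : BTempCat 𝒢))
    (ω₀ : BTemp.Orbits (c.equiv.functor.obj ⟨S, hS⟩)) (v : 𝒢.graph.Vertex) (ω : BTemp.Orbits (S.SV v))
    (χ₀ : 𝒢.Gv v →ₜ* c.G) (hχ₀ : IsVerticialHom c v χ₀) :
    ∃ (χ : 𝒢.Gv v →ₜ* c.G) (k : ObjectProperty.ι _ ⋙ restrictV 𝒢 v ≅ c.equiv.functor ⋙ BTemp.res χ),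
      IsVerticialHom c v χ ∧
      (k.hom.app ⟨S, hS⟩).hom.hom (Quot.out ω) = (Quot.out ω₀ : (c.equiv.functor.obj ⟨S, hS⟩).obj.V) := by
  haveI := c.isTopologicalGroup
  obtain ⟨j₀⟩ := hχ₀
  let X : BTemp c.G := c.equiv.functor.obj ⟨S, hS⟩
  let x₀ : X.obj.V := Quot.out ω₀
  let s : (S.SV v).obj.V := Quot.out ω
  let G₁ : BTempCat 𝒢 ⥤ BTemp (𝒢.Gv v) := ObjectProperty.ι _ ⋙ restrictV 𝒢 v
  let k₀ : G₁ ≅ c.equiv.functor ⋙ BTemp.res χ₀ :=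
    (Functor.isoWhiskerRight c.equiv.unitIso G₁ : 𝟭 _ ⋙ G₁ ≅ (c.equiv.functor ⋙ c.equiv.inverse) ⋙ G₁) ≪≫
      (Functor.isoWhiskerLeft c.equiv.functor j₀ :
        c.equiv.functor ⋙ (c.equiv.inverse ⋙ G₁) ≅ c.equiv.functor ⋙ BTemp.res χ₀)
  let y₀ : X.obj.V := (k₀.hom.app ⟨S, hS⟩).hom.hom s
  obtain ⟨g, hg⟩ := S.exists_ρ_eq_of_isConnectedObj_chart c hS hSc x₀ y₀
  let κ : c.G →ₜ* c.G :=
    { toMonoidHom := (MulAut.conj g⁻¹).toMonoidHom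
      continuous_toFun := by
        change Continuous fun x => g⁻¹ * x * g⁻¹⁻¹
        fun_prop }
  let χ : 𝒢.Gv v →ₜ* c.G := κ.comp χ₀
  have hχ : ∀ a, g⁻¹ * χ₀ a * g⁻¹⁻¹ = χ a := fun _ => rfl
  let r : BTemp.res χ₀ ≅ BTemp.res χ := BTemp.resIsoOfConj χ₀ χ g⁻¹ hχ
  refine ⟨χ, k₀ ≪≫ Functor.isoWhiskerLeft c.equiv.functor r, ⟨j₀ ≪≫ r⟩, ?_⟩
  change ((r.hom.app X).hom.hom ((k₀.hom.app ⟨S, hS⟩).hom.hom s) : X.obj.V) = x₀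
  rw [BTemp.resIsoOfConj_hom_app_apply]
  change X.obj.ρ g⁻¹ y₀ = x₀
  rw [← hg, ρ_inv_apply]

/-- **A verticial homomorphism of `G_S` at EVERY vertex `(v, ω)`**, of the form `φ ∘ ψ` with `ψ` the
restriction of a verticial homomorphism `χ` of `G` at `v` to `Stab_{Π_v}(s_ω) = χ⁻¹(Stab_Π(x₀))`
(for `S` connected). [cite: MochizukiSemiAnbd2006, Thm 3.7(i) p.40] -/
theorem exists_isVerticialHom_coveringGraph_at (h36 : 𝒢.Prop36Hypotheses) (hcoh : 𝒢.IsCoherent)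
    (c : TemperedPiChart 𝒢) (hS : S.IsTempered) (hSc : IsConnectedObj (⟨S, hS⟩ : BTempCat 𝒢))
    (cS : TemperedPiChart S.coveringGraph) (ω₀ : BTemp.Orbits (c.equiv.functor.obj ⟨S, hS⟩))
    (φ : BTemp.stab (c.equiv.functor.obj ⟨S, hS⟩) (Quot.out ω₀) →ₜ* cS.G)
    (hφ : Nonempty (cS.equiv.inverse ⋙ (S.etaleEquiv uniformSplitting_holds h36 hcoh hS).functor ⋙
          (Over.postEquiv (⟨S, hS⟩ : BTempCat 𝒢) c.equiv).functor ⋙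
          BTemp.fibreFamily (c.equiv.functor.obj ⟨S, hS⟩) ⋙
          Pi.eval (fun ω => BTemp (BTemp.stab (c.equiv.functor.obj ⟨S, hS⟩) (Quot.out ω))) ω₀ ≅
        BTemp.res φ))
    (v : 𝒢.graph.Vertex) (ω : BTemp.Orbits (S.SV v)) :
    ∃ (χ : 𝒢.Gv v →ₜ* c.G)
      (ψ : BTemp.stab (S.SV v) (Quot.out ω) →ₜ* BTemp.stab (c.equiv.functor.obj ⟨S, hS⟩) (Quot.out ω₀)),
      IsVerticialHom c v χ ∧
      (∀ h, ((ψ h : BTemp.stab (c.equiv.functor.obj ⟨S, hS⟩) (Quot.out ω₀)) : c.G) = χ (h : 𝒢.Gv v)) ∧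
      (∀ b : 𝒢.Gv v, b ∈ BTemp.stab (S.SV v) (Quot.out ω) ↔
        χ b ∈ BTemp.stab (c.equiv.functor.obj ⟨S, hS⟩) (Quot.out ω₀)) ∧
      IsVerticialHom cS (⟨v, ω⟩ : S.coveringGraph.graph.Vertex) (φ.comp ψ) := by
  obtain ⟨χ₀, hχ₀⟩ := exists_isVerticialHom h36.isQuasiCoherent h36.isGaloisCountable c v
  obtain ⟨χ, k, hχv, hk⟩ := S.exists_isVerticialHom_normalised_at c hS hSc ω₀ v ω χ₀ hχ₀
  obtain ⟨ψ, hψ, hiff, ⟨i⟩⟩ := S.exists_ptFibre_compat c hS ω₀ v ω χ k hk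
  obtain ⟨iφ⟩ := hφ
  refine ⟨χ, ψ, hχv, hψ, hiff, ⟨?_⟩⟩
  let X : BTemp c.G := c.equiv.functor.obj ⟨S, hS⟩
  let et := S.etaleEquiv uniformSplitting_holds h36 hcoh hS
  let R : BTempCat S.coveringGraph ⥤ BTemp (BTemp.stab (S.SV v) (Quot.out ω)) :=
    ObjectProperty.ι _ ⋙ restrictV S.coveringGraph (⟨v, ω⟩ : S.coveringGraph.graph.Vertex)
  let F₁ := Over.post (X := (⟨S, hS⟩ : BTempCat 𝒢)) (ObjectProperty.ι _ ⋙ restrictV 𝒢 v) ⋙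
    BTemp.fibreFamily (S.SV v) ⋙ Pi.eval (fun ω' => BTemp (BTemp.stab (S.SV v) (Quot.out ω'))) ω
  let F₂ := (Over.postEquiv (⟨S, hS⟩ : BTempCat 𝒢) c.equiv).functor ⋙ BTemp.fibreFamily X ⋙
    Pi.eval (fun ω' => BTemp (BTemp.stab X (Quot.out ω'))) ω₀
  let i1 : R ≅ et.functor ⋙ F₁ :=
    (Functor.isoWhiskerRight et.unitIso R : 𝟭 _ ⋙ R ≅ (et.functor ⋙ et.inverse) ⋙ R)
  let i2 : et.functor ⋙ F₁ ≅ et.functor ⋙ F₂ ⋙ BTemp.res ψ := Functor.isoWhiskerLeft et.functor i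
  let i3 : cS.equiv.inverse ⋙ R ≅ (cS.equiv.inverse ⋙ et.functor ⋙ F₂) ⋙ BTemp.res ψ :=
    Functor.isoWhiskerLeft cS.equiv.inverse (i1 ≪≫ i2)
  exact i3 ≪≫ (Functor.isoWhiskerRight iφ (BTemp.res ψ) :
    (cS.equiv.inverse ⋙ et.functor ⋙ F₂) ⋙ BTemp.res ψ ≅ BTemp.res φ ⋙ BTemp.res ψ)

/-! ### The transfer -/

/-- **[SemiAnbd] Theorem 3.7 (iii) transfers along tempered coverings.**  For `G` as in Theorem 3.7
and coherent, with Thm. 3.7 (iii) holding AT `G` (`CompactInVerticialAt G`, e.g. for finite `G`), and a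
connected tempered covering `S`, Thm. 3.7 (iii) holds AT the covering semi-graph of anabelioids `G_S`:
every compact subgroup of `π₁^temp(G_S)` lies in a verticial subgroup; a nontrivial one lies in at most
two, and then in an edge-like subgroup of a closed edge. [cite: MochizukiSemiAnbd2006, Thm 3.7(iii) pp.40-41] -/
theorem compactInVerticialAt_coveringGraph (h𝒢 : 𝒢.Thm37Hypotheses) (hcoh : 𝒢.IsCoherent)
    (hiii : CompactInVerticialAt 𝒢) (hS : S.IsTempered)
    (hSc : IsConnectedObj (⟨S, hS⟩ : BTempCat 𝒢)) : CompactInVerticialAt S.coveringGraph := by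
  intro _ cS C hC
  classical
  have h36 : 𝒢.Prop36Hypotheses := h𝒢.toProp36Hypotheses
  obtain ⟨c⟩ := ExistsTemperedPiChart_holds 𝒢 h36
  haveI := c.isTopologicalGroup
  haveI := cS.isTopologicalGroup
  let X : BTemp c.G := c.equiv.functor.obj ⟨S, hS⟩
  obtain ⟨x⟩ := nonempty_of_isConnectedObj X (TemperoidTransport.isConnectedObj_functor_obj c.equiv hSc)
  let ω₀ : BTemp.Orbits X := BTemp.cl X x
  let x₀ : X.obj.V := Quot.out ω₀
  let U : Subgroup c.G := BTemp.stab X x₀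
  -- T1: `π₁^temp(G_S) ≅ U`
  obtain ⟨φ, ψT, hψφ, hφψ, ⟨iφ⟩⟩ := S.exists_chartGroup_compatIso h36 hcoh c hS hSc cS ω₀
  -- the embedding `ι : π₁^temp(G_S) → Π` and the image `C'` of `C`
  let ι : cS.G →* c.G := U.subtype.comp ψT.toMonoidHom
  have hιcont : Continuous ι := continuous_subtype_val.comp ψT.continuous
  have hιinj : Function.Injective ι := by
    intro y₁ y₂ h
    have : ψT y₁ = ψT y₂ := Subtype.ext h
    simpa [hφψ] using congrArg φ this
  have hι : ∀ y, ι y = ((ψT y : U) : c.G) := fun _ => rfl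
  have hιU : ∀ y, ι y ∈ U := fun y => (ψT y).2
  have hιφ : ∀ u : U, ι (φ u) = (u : c.G) := fun u => by rw [hι, hψφ]
  let C' : Subgroup c.G := C.map ι
  have hC' : IsCompact (C' : Set c.G) := by
    rw [Subgroup.coe_map]
    exact hC.image hιcont
  -- the dictionary, in subgroup form
  -- (D1) the image of `range (φ ∘ ψ)` is `range χ ∩ U`
  have hD1 : ∀ {v : 𝒢.graph.Vertex} {ω : BTemp.Orbits (S.SV v)} (χ : 𝒢.Gv v →ₜ* c.G)
      (ψ : BTemp.stab (S.SV v) (Quot.out ω) →ₜ* U)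
      (hψ : ∀ h, ((ψ h : U) : c.G) = χ (h : 𝒢.Gv v))
      (hiff : ∀ b : 𝒢.Gv v, b ∈ BTemp.stab (S.SV v) (Quot.out ω) ↔ χ b ∈ U) (z : c.G),
      z ∈ ((φ.comp ψ).toMonoidHom.range).map ι ↔ z ∈ χ.toMonoidHom.range ∧ z ∈ U := by
    intro v ω χ ψ hψ hiff z
    constructor
    · rintro ⟨_, ⟨h, rfl⟩, rfl⟩
      refine ⟨⟨(h : 𝒢.Gv v), ?_⟩, hιU _⟩
      change χ h = ι (φ (ψ h))
      rw [hιφ, hψ]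
    · rintro ⟨⟨b, rfl⟩, hbU⟩
      have hb : b ∈ BTemp.stab (S.SV v) (Quot.out ω) := (hiff b).mpr hbU
      refine ⟨(φ.comp ψ) ⟨b, hb⟩, ⟨⟨b, hb⟩, rfl⟩, ?_⟩
      change ι (φ (ψ ⟨b, hb⟩)) = χ b
      rw [hιφ, hψ]
  -- (D2) every verticial subgroup of `G_S` is the trace of a verticial subgroup of `G`
  have hD2 : ∀ (w : S.coveringGraph.graph.Vertex) (K : Subgroup cS.G),
      K ∈ verticialSubgroups cS w →
        ∃ H : Subgroup c.G, H ∈ verticialSubgroups c w.1 ∧ ∀ z, z ∈ K.map ι ↔ z ∈ H ∧ z ∈ U := by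
    rintro ⟨v, ω⟩ K hK
    obtain ⟨χ, ψ, hχv, hψ, hiff, hθ⟩ :=
      S.exists_isVerticialHom_coveringGraph_at h36 hcoh c hS hSc cS ω₀ φ ⟨iφ⟩ v ω
    have hθmem : (φ.comp ψ).toMonoidHom.range ∈ verticialSubgroups cS ⟨v, ω⟩ := ⟨φ.comp ψ, hθ, rfl⟩
    obtain ⟨y, rfl⟩ := exists_conj_of_mem_verticialSubgroups cS hθmem hK
    have hχmem : χ.toMonoidHom.range ∈ verticialSubgroups c v := ⟨χ, hχv, rfl⟩
    refine ⟨(χ.toMonoidHom.range).map (MulAut.conj (ι y)).toMonoidHom,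
      conj_mem_verticialSubgroups c hχmem (ι y), fun z => ?_⟩
    -- `ι` intertwines conjugation by `y` and by `ι y`
    have key : ((φ.comp ψ).toMonoidHom.range.map (MulAut.conj y).toMonoidHom).map ι =
        (((φ.comp ψ).toMonoidHom.range).map ι).map (MulAut.conj (ι y)).toMonoidHom := by
      rw [Subgroup.map_map, Subgroup.map_map]
      congr 1
      ext w
      change ι (y * w * y⁻¹) = ι y * ι w * (ι y)⁻¹
      rw [map_mul, map_mul, map_inv]
    rw [key]
    constructor
    · rintro ⟨w, hw, rfl⟩
      obtain ⟨hw1, hw2⟩ := (hD1 χ ψ hψ hiff w).mp hw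
      refine ⟨⟨w, hw1, rfl⟩, ?_⟩
      change ι y * w * (ι y)⁻¹ ∈ U
      exact U.mul_mem (U.mul_mem (hιU y) hw2) (U.inv_mem (hιU y))
    · rintro ⟨⟨w, hw1, rfl⟩, hzU⟩
      refine ⟨w, (hD1 χ ψ hψ hiff w).mpr ⟨hw1, ?_⟩, rfl⟩
      have : (ι y)⁻¹ * (ι y * w * (ι y)⁻¹) * ι y ∈ U :=
        U.mul_mem (U.mul_mem (U.inv_mem (hιU y)) hzU) (hιU y)
      simpa [mul_assoc] using this
  -- membership transfer: `C ≤ M ↔ C' ≤ M.map ι`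
  have hle : ∀ M : Subgroup cS.G, C ≤ M ↔ C' ≤ M.map ι := by
    intro M
    constructor
    · exact fun h => Subgroup.map_mono h
    · intro h y hy
      obtain ⟨y', hy', hyy'⟩ := h ⟨y, hy, rfl⟩
      exact hιinj hyy' ▸ hy'
  obtain ⟨h1, h2⟩ := hiii h𝒢 c C' hC'
  refine ⟨?_, ?_⟩
  · -- clause 1
    obtain ⟨v, H, ⟨χ₀, hχ₀, rfl⟩, hC'H⟩ := h1
    obtain ⟨ω, a, χ, ψ, hχ, hψ, hiff, hθ⟩ :=
      S.exists_isVerticialHom_coveringGraph h36 hcoh c hS cS ω₀ φ ⟨iφ⟩ v χ₀ hχ₀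
    refine ⟨⟨v, ω⟩, (φ.comp ψ).toMonoidHom.range, ⟨φ.comp ψ, hθ, rfl⟩, ?_⟩
    rw [hle]
    intro z hz
    rw [hD1 χ ψ hψ hiff]
    refine ⟨?_, ?_⟩
    · obtain ⟨b, hb⟩ := hC'H hz
      refine ⟨a * b * a⁻¹, ?_⟩
      change χ (a * b * a⁻¹) = z
      rw [hχ, ← hb]
      change χ₀ (a⁻¹ * (a * b * a⁻¹) * a) = χ₀ b
      congr 1
      group
    · obtain ⟨y, -, rfl⟩ := hz
      exact hιU y
  · -- clause 2
    intro hCne w₁ w₂ K₁ K₂ hK₁ hK₂ hne hC₁ hC₂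
    have hC'ne : C' ≠ ⊥ := by
      intro h
      apply hCne
      rw [eq_bot_iff]
      intro y hy
      have : ι y ∈ C' := ⟨y, hy, rfl⟩
      rw [h, Subgroup.mem_bot] at this
      exact (Subgroup.mem_bot).mpr (hιinj (this.trans (map_one ι).symm))
    obtain ⟨H₁, hH₁, hH₁'⟩ := hD2 w₁ K₁ hK₁
    obtain ⟨H₂, hH₂, hH₂'⟩ := hD2 w₂ K₂ hK₂
    have htr : ∀ {M : Subgroup cS.G} {K : Subgroup c.G}, (∀ z, z ∈ M.map ι ↔ z ∈ K ∧ z ∈ U) →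
        C ≤ M → C' ≤ K := fun hK h z hz => ((hK z).mp ((hle _).mp h hz)).1
    have hinj : ∀ {M₁ M₂ : Subgroup cS.G} {K : Subgroup c.G},
        (∀ z, z ∈ M₁.map ι ↔ z ∈ K ∧ z ∈ U) → (∀ z, z ∈ M₂.map ι ↔ z ∈ K ∧ z ∈ U) → M₁ = M₂ := by
      intro M₁ M₂ K h₁' h₂'
      apply Subgroup.map_injective hιinj
      ext z
      rw [h₁', h₂']
    have hH₁₂ : H₁ ≠ H₂ := by
      rintro rfl
      exact hne (hinj hH₁' hH₂')
    obtain ⟨honly, e, L, he, ⟨χ₀, hχ₀, rfl⟩, hC'L⟩ :=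
      h2 hC'ne w₁.1 w₂.1 H₁ H₂ hH₁ hH₂ hH₁₂ (htr hH₁' hC₁) (htr hH₂' hC₂)
    refine ⟨fun w₃ K₃ hK₃ hC₃ => ?_, ?_⟩
    · obtain ⟨H₃, hH₃, hH₃'⟩ := hD2 w₃ K₃ hK₃
      rcases honly w₃.1 H₃ hH₃ (htr hH₃' hC₃) with rfl | rfl
      · exact Or.inl (hinj hH₃' hH₁')
      · exact Or.inr (hinj hH₃' hH₂')
    · obtain ⟨ω, a, χ, ψ, hχ, hψ, hiff, hθ⟩ :=
        S.exists_isEdgeHom_coveringGraph h36 hcoh c hS cS ω₀ φ ⟨iφ⟩ e χ₀ hχ₀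
      refine ⟨⟨e, ω⟩, (φ.comp ψ).toMonoidHom.range, S.isClosedEdge_coveringSemiGraph he ω,
        ⟨φ.comp ψ, hθ, rfl⟩, ?_⟩
      rw [hle]
      intro z hz
      -- the edge analogue of (D1), inlined
      obtain ⟨b, hb⟩ := hC'L hz
      obtain ⟨y, -, rfl⟩ := hz
      have hb₀ : χ₀ b = ι y := hb
      have hab : a⁻¹ * (a * b * a⁻¹) * a = b := by group
      have hbU : χ (a * b * a⁻¹) ∈ U := by
        rw [hχ, hab, hb₀]
        exact hιU y
      have hb' : a * b * a⁻¹ ∈ BTemp.stab (S.SE e) (Quot.out ω) := (hiff _).mpr hbU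
      refine ⟨(φ.comp ψ) ⟨a * b * a⁻¹, hb'⟩, ⟨⟨a * b * a⁻¹, hb'⟩, rfl⟩, ?_⟩
      change ι (φ (ψ ⟨a * b * a⁻¹, hb'⟩)) = ι y
      rw [hιφ, hψ]
      change χ (a * b * a⁻¹) = ι y
      rw [hχ, hab, hb₀]

end CovObj

end ProfiniteSemiGraph

end Literature.AnabelianGeometry.SemiGraphs

end
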